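import Summits.BirchSwinnertonDyer.BirchSwinnertonDyer.Theorems.SchneiderFreeAdditiveX3AnticycControlAdditiveBaseCountExactAnyTorsion
import HarnessLib

/-!
# Route `ErratumRoadFive` (rung K2), support item 19626 `JSWAnticyclotomicControlMult` — the rank-one base Selmer count, ANY torsion,
# under `Ш(E/K)[p^∞]` FINITE ONLY (the Jetchev–Skinner–Wan hypothesis), instead of all of `Ш(E/K)` finite
# (cell `bsd-stepL`, seat `bsd-stepL-imc-p1` g16; `--supports stmt-BirchSwinnertonDyer-19626`; Theses-free)

HONEST FRAMING: theorems only (no definition, no named fact, no `sorry`); CONDITIONAL on the cited facts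
`poitouTate_sum_localTatePairing_eq_zero K` ∕ `poitouTate_selmerStructure_duality K` and `localEulerPoincareCharacteristic`
exactly as the originals; nothing is asserted about any curve; BSD is proved for no pair; no count moves (T7).

## What this file proves

JSW17 Thm. 3.3.1 (the route's support item 19626, `JetchevSkinnerWan2017.thm331_anticyclotomicControl_mult`) assumes
`#Ш(E/K)[p^∞] < ∞` — NOT the finiteness of all of `Ш(E/K)`. The tree's torsion-robust base count (bsd-eis door-c6,
`SchneiderFreeAdditiveX3.finite_selmerAcBase_of_rankOne_anyTorsion` ∕ `….natCard_selmerAcBase_mul_eq_of_rankOne_anyTorsion`)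
takes `(W.baseChange K).ShaFinite`, but uses it ONLY through the finite `p`-primary part (`#Ш[p^∞] = p^t`, `Ш ∩ H¹[p^k] ↪ Ш[p^∞]`),
for which multr1-p2 already proved the `p`-primary lemmas `SelmerCount.natCard_sha_inf_torsionBy_le_of_finite`,
`SelmerCount.natCard_sha_inf_torsionBy_eq'`, `SelmerCount.pow_nsmul_eq_zero_of_mem_sha_inf_torsionBy'`,
`SelmerCount.exists_natCard_primaryComponent_eq_pow_of_finite` (`BDPRouteSelmerCountLemmas` §4). This file re-runs the two
proofs VERBATIM with the hypothesis `hSha : Finite (Ш(E/K)[p^∞])` and those four lemmas substituted: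

* `finite_selmerAcBase_of_rankOne_anyTorsion_shaPrimary` — Castella's `Sel_𝔭(K, E[p^∞])` is finite at a rank-one datum
  (`rank E(K) = 1`, `Ш(E/K)[p^∞]` finite, `K` imaginary quadratic, `p` split, `𝔭 ∣ p` of degree one), any reduction, any torsion;
* `natCard_selmerAcBase_mul_eq_of_rankOne_anyTorsion_shaPrimary` — the exact count
  `#Sel_𝔭(K,E[p^∞]) · #E(ℚ_p)[p^∞] = p^a`, `a = ord_p #Ш[p^∞] + 2((ord_p log_ω P + ord_p #Ẽ_ns(𝔽_p) − 1) − ord_p[E(K):ℤP]) +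
  ord_p ∏_{w∣p} c_w + ord_p #E(K)[p^∞]`.

Used by `Theorems/ErratumRoadFiveJSWControlMultOfFacts.lean` to derive the JSW fact itself from the two Poitou–Tate facts. References:
[JetchevSkinnerWan2017] Prop. 3.2.1, (7.1.5), §3.5 (Ш 𝔭-finite); [KellerYin2024] App. B Thm. B.0.6; [MilneADT2006] I Thm. 4.10(b), Thm. 2.8.
-/

noncomputable section

open scoped Classical
open WeierstrassCurve NumberField IsDedekindDomain Field Function
open Literature.NumberTheory.EllipticCurves Literature.NumberTheory.EllipticCurves.GreenbergSelmer
  Literature.NumberTheory.EllipticCurves.ModularForms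
  Literature.NumberTheory.EllipticCurves.Rank1Residual
  Literature.NumberTheory.EllipticCurves.Rank1Residual.Typed
  Literature.NumberTheory.EllipticCurves.Wuthrich2014
  Literature.NumberTheory.EllipticCurves.BalakrishnanEtAl2019
  Literature.NumberTheory.QuadraticFields.Quadratic
  Literature.NumberTheory.Automorphic
  Literature.NumberTheory.GaloisRepresentations Literature.NumberTheory.GaloisCohomology
  Summit.BirchSwinnertonDyer.Rank1Residual
  Summit.BirchSwinnertonDyer.Rank1Residual.X11b
  Summit.BirchSwinnertonDyer.Rank1Residual.X11b.AcSelmer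
  Summit.BirchSwinnertonDyer.Rank1Residual.X11b.LocBridge
  Summit.BirchSwinnertonDyer.Rank1Residual.X11b.SelmerLevelBound

set_option autoImplicit false
set_option linter.dupNamespace false

namespace Summit.BirchSwinnertonDyer.BirchSwinnertonDyer.Theorems.SchneiderFreeAdditiveX3

section Finite

/-- **Castella's Selmer group `Sel_𝔭(K, E[p^∞])` is FINITE at a rank-one datum, ANY reduction, ANY torsion, under `Ш(E/K)[p^∞]`
finite only** — `finite_selmerAcBase_of_rankOne_anyTorsion` VERBATIM with `hSha : Finite Ш[p^∞]` and the `p`-primary lemma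
`SelmerCount.natCard_sha_inf_torsionBy_le_of_finite` in place of `natCard_sha_inf_torsionBy_le`. CONDITIONAL on the cited
`poitouTate_sum_localTatePairing_eq_zero K`. [cite: JetchevSkinnerWan2017, Prop. 3.2.1 (proof, arXiv:1512.06894 pp. 10–11) and §3.5 (Ш 𝔭-finite)]
[cite: Castella2018, proof of Thm. 2.3, (3.2.1) and (calcul) (arXiv:1704.06608 pp. 5–6)]
[cite: MilneADT2006, Ch. I, Thm. 4.10(b) and Thm. 2.8] -/
theorem finite_selmerAcBase_of_rankOne_anyTorsion_shaPrimary (W : WeierstrassCurve ℚ) [W.IsElliptic]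
    [W.IsGloballyMinimal] (p : ℕ) [Fact p.Prime] (K : Type) [Field K] [NumberField K]
    (hPT : poitouTate_sum_localTatePairing_eq_zero K)
    (hK : IsImaginaryQuadratic K) (hsplit : SplitsIn K p)
    (hrank : (W.baseChange K).mordellWeilRank = 1)
    (hSha : Finite (AddCommGroup.primaryComponent (W.baseChange K).sha p))
    (𝔭 : HeightOneSpectrum (𝓞 K)) (h𝔭 : ((p : ℕ) : 𝓞 K) ∈ 𝔭.asIdeal)
    (he : 𝔭.asIdeal.ramificationIdx (𝓞 ℚ) = 1) (hf : 𝔭.asIdeal.inertiaDeg (𝓞 ℚ) = 1) :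
    Finite (selmerAcBase (W.baseChange K) p 𝔭 ∅) := by
  set E := W.baseChange K with hEdef
  set G := W.baseChange ℚ_[p] with hGdef
  haveI hEK : E.IsElliptic := by rw [hEdef, baseChange]; infer_instance
  have h2 : Module.finrank ℚ K = 2 := hK.1
  have hp : p.Prime := Fact.out
  haveI hShaFin : Finite (AddCommGroup.primaryComponent E.sha p) := hSha
  haveI : Finite (AddCommGroup.torsion E.toAffine.Point) := E.finite_torsion_point
  set ιp := embAt K p 𝔭 h𝔭 he hf with hιp
  set f : E.toAffine.Point →+ G.toAffine.Point := Affine.Point.map (W' := W) ιp.toRatAlgHom with hfdef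
  have hfinj : Function.Injective f := Affine.Point.map_injective (W' := W) ιp.toRatAlgHom
  -- a coordinate `c : E(K) → ℤ` and a generator `Q` (torsion ALLOWED)
  obtain ⟨c, Q, hcQ, hcker⟩ := RankOne.exists_coord_of_mordellWeilRank_eq_one E hrank
  have hA : ∀ a : E.toAffine.Point, IsOfFinAddOrder (a - c a • Q) :=
    RankOne.isOfFinAddOrder_sub_coord_zsmul c Q hcQ hcker
  have hQinf : ¬ IsOfFinAddOrder Q := fun hQ => by
    have h := RankOne.coord_eq_zero_of_isOfFinAddOrder c hQ
    rw [hcQ] at h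
    exact one_ne_zero h
  have hxinf : ¬ IsOfFinAddOrder (f Q) := fun hx => hQinf ((hfinj.isOfFinAddOrder_iff).mp hx)
  -- the `ℤ_p`-coordinate `Ψ` on `E(ℚ_p)`: `Ψ(E(ℚ_p)) = p^m ℤ_p`, `p^m = #E(ℚ_p)[p^∞]`
  haveI hfi2 : (G.formalFiltration 2).FiniteIndex := G.finiteIndex_formalFiltration 2
  obtain ⟨φ, -⟩ := LocalIndex.exists_addEquiv_valuation_psi_padicPointOf W p (K := K)
  obtain ⟨m, hmrange, hmcard, -⟩ :=
    LocalIndex.exists_pow_eq_card_and_le_valuation_psi (G.formalFiltration 2) φ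
  haveI : Finite (AddCommGroup.torsion G.toAffine.Point) :=
    LocalIndex.finite_torsion (G.formalFiltration 2) φ
  set eQ := (LocalIndex.psi (G.formalFiltration 2) φ (f Q)).valuation with heQdef
  -- the subgroup `p^k E(ℚ_p) + ℤ f(Q)` has finite (indeed `p`-power times `#E(ℚ_p)[p^∞]`) index
  have hH₀ : ∀ k : ℕ, (((nsmulAddMonoidHom (p ^ k) : G.toAffine.Point →+ _).range ⊔
      AddSubgroup.zmultiples (f Q))).index ≠ 0 := fun k ↦ by
    set H₀ := (nsmulAddMonoidHom (p ^ k) : G.toAffine.Point →+ _).range ⊔ AddSubgroup.zmultiples (f Q)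
    rw [← AddSubgroup.relIndex_mul_index (le_sup_right : H₀ ≤ AddCommGroup.torsion G.toAffine.Point ⊔ H₀),
      AddSubgroup.relIndex_sup_right,
      LocalIndex.index_torsion_sup_range_nsmul_sup_zmultiples (G.formalFiltration 2) φ hmrange (f Q)
        hxinf k]
    exact mul_ne_zero AddSubgroup.FiniteIndex.index_ne_zero (pow_ne_zero _ hp.ne_zero)
  -- the two primes above `p`
  obtain ⟨σ, 𝔮, hσ, -, -, hall⟩ := LocalIndexTransport.exists_conj_prime_of_splitsIn K p h2 hsplit h𝔭
  have h𝔮 : ∀ v : HeightOneSpectrum (𝓞 K), v ≠ 𝔭 → ((p : ℕ) : 𝓞 K) ∈ v.asIdeal → v = 𝔮 :=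
    fun v hv hpv => (hall v hpv).resolve_left hv
  -- `#Ш[p^∞] = S`
  set S := Nat.card (AddCommGroup.primaryComponent E.sha p) with hSdef
  set Tg := Nat.card (AddCommGroup.torsion E.toAffine.Point) with hTg
  -- THE LEVEL BOUNDS (uniform in `k`)
  set B : ℕ := (p ^ (eQ - m) * p ^ m) * (S * p ^ (eQ - m) * Tg) with hBdef
  have hS1 : 1 ≤ S := Nat.one_le_iff_ne_zero.mpr Nat.card_pos.ne'
  have hTg1 : 1 ≤ Tg := Nat.one_le_iff_ne_zero.mpr Nat.card_pos.ne'
  have hlevel : ∀ k, Finite (acLevelStructure E p k 𝔭 ∅).selmerGroup ∧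
      Nat.card (acLevelStructure E p k 𝔭 ∅).selmerGroup ≤ B := by
    intro k
    rcases Nat.eq_zero_or_pos k with rfl | hk
    · obtain ⟨hfin, hle⟩ := finite_and_natCard_selmerGroup_acLevelStructure_zero E p 𝔭 ∅
      refine ⟨hfin, hle.trans ?_⟩
      calc 1 ≤ S := hS1
        _ ≤ S * p ^ (eQ - m) := Nat.le_mul_of_pos_right _ (pow_pos hp.pos _)
        _ ≤ S * p ^ (eQ - m) * Tg := Nat.le_mul_of_pos_right _ hTg1
        _ ≤ (p ^ (eQ - m) * p ^ m) * (S * p ^ (eQ - m) * Tg) :=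
            Nat.le_mul_of_pos_left _ (Nat.mul_pos (pow_pos hp.pos _) (pow_pos hp.pos _))
    · haveI : NeZero (p ^ k) := ⟨pow_ne_zero _ hp.ne_zero⟩
      -- the indices at level `k`, read in `E(ℚ_p)` through `Ψ`
      have hL₁ : ((Affine.Point.baseChange (W' := W.baseChange K) K (𝔭.adicCompletion K)).range ⊔
          (zsmulAddGroupHom ((p ^ k : ℕ) : ℤ) :
            ((W.baseChange K).baseChange (𝔭.adicCompletion K)).toAffine.Point →+ _).range).index ≤
          p ^ min k (eQ - m) * p ^ m := by
        rw [LocalIndexTransport.index_range_baseChange_sup_eq_padic K p 𝔭 h𝔭 he hf W,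
          RankOne.range_zsmulAddGroupHom_natCast, sup_comm]
        change ((nsmulAddMonoidHom (p ^ k) : G.toAffine.Point →+ _).range ⊔ f.range).index ≤ _
        haveI : (((nsmulAddMonoidHom (p ^ k) : G.toAffine.Point →+ _).range ⊔
            AddSubgroup.zmultiples (f Q))).FiniteIndex := ⟨hH₀ k⟩
        refine (index_range_nsmul_sup_range_le f Q (p ^ k)).trans ?_
        rw [hmcard]
        exact LocalIndex.index_range_nsmul_sup_zmultiples_le (G.formalFiltration 2) φ hmrange
          (f Q) hxinf k
      have hM : (AddCommGroup.torsion ((W.baseChange K).baseChange (𝔭.adicCompletion K)).toAffine.Point ⊔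
          (zsmulAddGroupHom ((p ^ k : ℕ) : ℤ) :
            ((W.baseChange K).baseChange (𝔭.adicCompletion K)).toAffine.Point →+ _).range).index =
          p ^ k := by
        rw [index_torsion_sup_range_zsmul_eq_padic K p 𝔭 h𝔭 he hf W,
          RankOne.range_zsmulAddGroupHom_natCast]
        exact LocalIndex.index_torsion_sup_range_nsmul (G.formalFiltration 2) φ k
      have hN : ((zsmulAddGroupHom ((p ^ k : ℕ) : ℤ) : E.toAffine.Point →+ _).range).index ≤
          p ^ k * Tg := index_range_zsmul_le_mul_card_torsion c Q hcQ hcker (p ^ k)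
      have hL₂ : ((Affine.Point.baseChange (W' := W.baseChange K) K (𝔭.adicCompletion K)).range ⊔
          (AddCommGroup.torsion ((W.baseChange K).baseChange (𝔭.adicCompletion K)).toAffine.Point ⊔
            (zsmulAddGroupHom ((p ^ k : ℕ) : ℤ) :
              ((W.baseChange K).baseChange (𝔭.adicCompletion K)).toAffine.Point →+ _).range)).index =
          p ^ min k (eQ - m) := by
        rw [index_range_baseChange_sup_torsion_sup_eq_padic K p 𝔭 h𝔭 he hf W,
          RankOne.range_zsmulAddGroupHom_natCast]
        change (f.range ⊔ (AddCommGroup.torsion G.toAffine.Point ⊔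
          (nsmulAddMonoidHom (p ^ k) : G.toAffine.Point →+ _).range)).index = _
        have hrw : f.range ⊔ (AddCommGroup.torsion G.toAffine.Point ⊔
            (nsmulAddMonoidHom (p ^ k) : G.toAffine.Point →+ _).range) =
            AddCommGroup.torsion G.toAffine.Point ⊔
              ((nsmulAddMonoidHom (p ^ k) : G.toAffine.Point →+ _).range ⊔
                AddSubgroup.zmultiples (f Q)) := by
          rw [← torsion_sup_range_nsmul_sup_range_eq f c Q hA (p ^ k)]
          ac_rfl
        rw [hrw]
        exact LocalIndex.index_torsion_sup_range_nsmul_sup_zmultiples (G.formalFiltration 2) φ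
          hmrange (f Q) hxinf k
      obtain ⟨hfin, hle⟩ := natCard_level_le_of_indices_anyTorsion W K p k 𝔭 𝔮 hk σ hσ h𝔮 hPT
        (localEulerPoincareCharacteristic_adicCompletionEP K 𝔮) hL₁ hM (pow_ne_zero _ hp.ne_zero) hN
        hL₂ (SelmerCount.natCard_sha_inf_torsionBy_le_of_finite E p k).2
      refine ⟨hfin, hle.trans ?_⟩
      have hmin : p ^ min k (eQ - m) ≤ p ^ (eQ - m) := Nat.pow_le_pow_right hp.pos (min_le_right _ _)
      exact Nat.mul_le_mul (Nat.mul_le_mul_right _ hmin)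
        (Nat.mul_le_mul (Nat.mul_le_mul_left _ hmin) le_rfl)
  -- pass to the limit
  obtain ⟨hfinSel, -⟩ := LevelKummer.exists_finite_selmerAcBase_natCard_le E p 𝔭 ∅
    E.zsmul_geomPoints_surjective_holds B (fun k => (hlevel k).1) (fun k => (hlevel k).2)
  exact hfinSel

end Finite

/-! ## §2. The exact base count under `Ш[p^∞]` finite -/

section Count

/-- **THE EXACT BASE SELMER COUNT at a rank-one datum, EVERY reduction type, ANY torsion, under `Ш(E/K)[p^∞]` finite only** —
`natCard_selmerAcBase_mul_eq_of_rankOne_anyTorsion` VERBATIM with `hSha : Finite Ш[p^∞]` and the `p`-primary lemmas of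
`BDPRouteSelmerCountLemmas` §4 (`…_of_finite`, `…'`). CONDITIONAL on `poitouTate_selmerStructure_duality K` and
`localEulerPoincareCharacteristic (K_v)`; `rank E(K) = 1` and `Ш(E/K)[p^∞]` finite are inputs.
[cite: JetchevSkinnerWan2017, Prop. 3.2.1 and (7.1.5) (arXiv:1512.06894 pp. 10–11, 16)]
[cite: KellerYin2024, App. B Thm. B.0.6 (arXiv:2402.12781 pp. 29–30)]
[cite: MilneADT2006, Ch. I, Thm. 4.10(b) and Thm. 2.8] -/
theorem natCard_selmerAcBase_mul_eq_of_rankOne_anyTorsion_shaPrimary (W : WeierstrassCurve ℚ) [W.IsElliptic]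
    [W.IsGloballyMinimal] (p : ℕ) [Fact p.Prime] (K : Type) [Field K] [NumberField K]
    (hPT : poitouTate_selmerStructure_duality K)
    (hEP : ∀ v : HeightOneSpectrum (𝓞 K), localEulerPoincareCharacteristic (v.adicCompletion K))
    (hK : IsImaginaryQuadratic K) (hsplit : SplitsIn K p)
    (hrank : (W.baseChange K).mordellWeilRank = 1)
    (hSha : Finite (AddCommGroup.primaryComponent (W.baseChange K).sha p))
    (P : (W.baseChange K).toAffine.Point) (hPinf : ¬ IsOfFinAddOrder P)
    (𝔭 : HeightOneSpectrum (𝓞 K)) (h𝔭 : ((p : ℕ) : 𝓞 K) ∈ 𝔭.asIdeal)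
    (he : 𝔭.asIdeal.ramificationIdx (𝓞 ℚ) = 1) (hf : 𝔭.asIdeal.inertiaDeg (𝓞 ℚ) = 1) :
    ∃ (_ : Finite (selmerAcBase (W.baseChange K) p 𝔭 ∅)) (a : ℕ),
      Nat.card (selmerAcBase (W.baseChange K) p 𝔭 ∅) *
          Nat.card (AddCommGroup.primaryComponent (W.baseChange ℚ_[p]).toAffine.Point p) = p ^ a ∧
      (a : ℤ) =
        (padicValNat p (Nat.card (AddCommGroup.primaryComponent (W.baseChange K).sha p)) : ℤ) +
        2 * ((X11b.padicLogOrd W p (embAt K p 𝔭 h𝔭 he hf) P + padicValNat p (reductionPointCount W p) - 1) -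
          (padicValNat p (AddSubgroup.zmultiples P).index : ℤ)) +
          padicValNat p (tamagawaProductAbove W K p) +
          padicValNat p (Nat.card (AddCommGroup.primaryComponent (W.baseChange K).toAffine.Point p)) := by
  -- adapted from door-c4 gen 2's `natCard_selmerAcBase_mul_eq_of_rankOne_anyReduction` (multr1-p2's count)
  revert P
  set E := W.baseChange K with hEdef
  set G := W.baseChange ℚ_[p] with hGdef
  intro P hPinf
  haveI hEK : E.IsElliptic := by rw [hEdef, baseChange]; infer_instance
  have h2 : Module.finrank ℚ K = 2 := hK.1
  haveI : IsTotallyComplex K := hK.2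
  have hKc : ∀ w : InfinitePlace K, w.IsComplex := fun w => IsTotallyComplex.isComplex w
  have hp : p.Prime := Fact.out
  haveI hShaFin : Finite (AddCommGroup.primaryComponent E.sha p) := hSha
  haveI : Finite (AddCommGroup.torsion E.toAffine.Point) := E.finite_torsion_point
  -- finiteness of Castella's Selmer group over `K` WITHOUT `E(K)[p] = 0` (door-c6 gen 0)
  have hPTsum : poitouTate_sum_localTatePairing_eq_zero K :=
    poitouTate_sum_localTatePairing_eq_zero_of_selmerStructure_duality hPT
  have hfinSel : Finite (selmerAcBase E p 𝔭 ∅) :=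
    finite_selmerAcBase_of_rankOne_anyTorsion_shaPrimary W p K hPTsum hK hsplit hrank hSha 𝔭 h𝔭 he hf
  -- the global torsion exponent `g`
  set g := padicValNat p (Nat.card (AddCommGroup.primaryComponent E.toAffine.Point p)) with hgdef
  have hcardg : Nat.card (AddCommGroup.primaryComponent E.toAffine.Point p) = p ^ g :=
    natCard_primaryComponent_point_eq_pow E p
  -- the `p`-adic bookkeeping of gens 16–18
  set ιp := embAt K p 𝔭 h𝔭 he hf with hιp
  set f : E.toAffine.Point →+ G.toAffine.Point := Affine.Point.map (W' := W) ιp.toRatAlgHom with hfdef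
  have hfinj : Function.Injective f := Affine.Point.map_injective (W' := W) ιp.toRatAlgHom
  obtain ⟨c, Q, hcQ, hcker⟩ := RankOne.exists_coord_of_mordellWeilRank_eq_one E hrank
  have hA : ∀ a : E.toAffine.Point, IsOfFinAddOrder (a - c a • Q) :=
    RankOne.isOfFinAddOrder_sub_coord_zsmul c Q hcQ hcker
  have hQinf : ¬ IsOfFinAddOrder Q := fun hQ => by
    have h := RankOne.coord_eq_zero_of_isOfFinAddOrder c hQ
    rw [hcQ] at h
    exact one_ne_zero h
  have hxinf : ¬ IsOfFinAddOrder (f Q) := fun hx => hQinf ((hfinj.isOfFinAddOrder_iff).mp hx)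
  have hyinf : ¬ IsOfFinAddOrder (f P) := fun hy => hPinf ((hfinj.isOfFinAddOrder_iff).mp hy)
  have hcP : c P ≠ 0 := fun h0 => hPinf (hcker P h0)
  haveI hfi2 : (G.formalFiltration 2).FiniteIndex := G.finiteIndex_formalFiltration 2
  set cp := padicValNat p (G.localTamagawaNumber ℤ_[p]) with hcpdef
  set ns := padicValNat p (reductionPointCount W p) with hnsdef
  obtain ⟨φ, hφ⟩ := LocalIndex.exists_addEquiv_valuation_psi_padicPointOf W p (K := K)
  obtain ⟨m, hmrange, hmcard, hmle⟩ :=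
    LocalIndex.exists_pow_eq_card_and_le_valuation_psi (G.formalFiltration 2) φ
  set Ψ := LocalIndex.psi (G.formalFiltration 2) φ with hΨ
  set eQ := (Ψ (f Q)).valuation with heQdef
  set eP := (Ψ (f P)).valuation with hePdef
  have hΨQ : Ψ (f Q) ≠ 0 := fun h0 => hxinf ((LocalIndex.psi_eq_zero_iff _ φ _).mp h0)
  have hmeQ : m ≤ eQ := hmle (f Q) hΨQ
  have heP : (eP : ℤ) = X11b.padicLogOrd W p ιp P + cp + ns - 1 := hφ ιp P hyinf
  have hyx : f P = c P • f Q + f (P - c P • Q) := by rw [map_sub, map_zsmul]; abel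
  have hePQ : eP = padicValNat p (c P).natAbs + eQ := by
    rw [hePdef, hyx]
    exact LocalIndex.valuation_psi_zsmul_add (G.formalFiltration 2) φ hxinf
      (f.isOfFinAddOrder (hA P)) hcP
  -- `ord_p [E(K) : ℤP] = ord_p |c(P)| + g`
  have hI : padicValNat p (AddSubgroup.zmultiples P).index = padicValNat p (c P).natAbs + g := by
    rw [padicValNat_index_zmultiples_eq_add c Q hcQ hcker P hcP, padicValNat_card_torsion_eq_padicValNat_card_primaryComponent E p]
  -- `[E(ℚ_p) : p^{k'} E(ℚ_p) + im E(K)] · p^g = p^{eQ}`, hence `g ≤ eQ`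
  have hL₁g : ∀ k' : ℕ, eQ ≤ k' →
      ((Affine.Point.baseChange (W' := W.baseChange K) K (𝔭.adicCompletion K)).range ⊔
        (zsmulAddGroupHom ((p ^ k' : ℕ) : ℤ) :
          ((W.baseChange K).baseChange (𝔭.adicCompletion K)).toAffine.Point →+ _).range).index * p ^ g =
        p ^ eQ := by
    intro k' hk'
    rw [LocalIndexTransport.index_range_baseChange_sup_eq_padic K p 𝔭 h𝔭 he hf W,
      RankOne.range_zsmulAddGroupHom_natCast, sup_comm, ← hcardg]
    change ((nsmulAddMonoidHom (p ^ k') : G.toAffine.Point →+ _).range ⊔ f.range).index * _ = _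
    exact index_range_nsmul_sup_range_mul_natCard_eq (G.formalFiltration 2) φ hmrange hmcard f hfinj c Q hcQ
      hcker hk'
  have hgeQ : g ≤ eQ := by
    have h := hL₁g eQ le_rfl
    exact (Nat.pow_dvd_pow_iff_le_right hp.one_lt).mp ⟨_, by rw [mul_comm]; exact h.symm⟩
  have htam : padicValNat p (tamagawaProductAbove W K p) = 2 * cp :=
    LocalIndexTransport.padicValNat_tamagawaProductAbove_eq_two_mul W K p h2 hsplit
  obtain ⟨σ, 𝔮, hσ, hne, h𝔮p, hall⟩ :=
    LocalIndexTransport.exists_conj_prime_of_splitsIn K p h2 hsplit h𝔭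
  obtain ⟨t, ht⟩ : ∃ t : ℕ, Nat.card (AddCommGroup.primaryComponent E.sha p) = p ^ t :=
    SelmerCount.exists_natCard_primaryComponent_eq_pow_of_finite p
  -- the exponent of Castella's Selmer group
  have hcardeq := AcSelmer.natCard_selmerAcBase_eq_natCard_selmerGroup E p 𝔭
    (∅ : Set (HeightOneSpectrum (𝓞 K)))
  haveI hfinH : Finite (acStructure (primaryGaloisModule E p) p 𝔭 ∅).selmerGroup := by
    apply Nat.finite_of_card_ne_zero
    rw [← hcardeq]
    haveI := hfinSel
    exact Nat.card_pos.ne'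
  obtain ⟨k₀, -, hk₀⟩ := AcSelmer.exists_pow_nsmul_eq_zero_of_finite
    (acStructure (primaryGaloisModule E p) p 𝔭 ∅).selmerGroup
  -- THE LEVEL `k`
  set k : ℕ := k₀ + ((eQ - m) + (eQ + t)) + g + 1 with hkdef
  have hk0 : 0 < k := by omega
  have hjk : (eQ - g) + t ≤ k := by omega
  have hsk : (eQ - m) + ((eQ - g) + t) ≤ k := by omega
  have hkill : ∀ x ∈ (acStructure (primaryGaloisModule E p) p 𝔭 ∅).selmerGroup, p ^ k • x = 0 := by
    intro x hx
    have hkk : k = (k - k₀) + k₀ := by omega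
    rw [hkk, pow_add, mul_nsmul', hk₀ x hx, nsmul_zero]
  have hkΓ : ∀ m' : E.geomPrimaryTorsion p, (∀ σ : absoluteGaloisGroup K, σ • m' = m') → p ^ k • m' = 0 :=
    pow_nsmul_eq_zero_of_forall_smul_eq E p (by omega)
  -- the level/limit relation WITH the kernel of `H¹(ι_k)` (this seat)
  have hcount : Nat.card (acLevelStructure E p k 𝔭 ∅).selmerGroup =
      p ^ g * Nat.card (selmerAcBase E p 𝔭 ∅) := by
    rw [natCard_level_eq_mul_natCard_selmerAcBase E p k 𝔭 ∅ hkΓ hkill,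
      natCard_fixedPoints_geomPrimaryTorsion_eq_natCard_primaryComponent E p, hcardg]
  -- the symbolic indices at level `k`, read in `E(ℚ_p)` through `Ψ`
  have hN : ((zsmulAddGroupHom ((p ^ k : ℕ) : ℤ) : E.toAffine.Point →+ _).range).index = p ^ k * p ^ g := by
    rw [← hcardg]
    exact index_range_zsmul_pow_eq_mul_of_le c Q hcQ hcker (by omega)
  have hM : (AddCommGroup.torsion ((W.baseChange K).baseChange (𝔭.adicCompletion K)).toAffine.Point ⊔
      (zsmulAddGroupHom ((p ^ k : ℕ) : ℤ) :
        ((W.baseChange K).baseChange (𝔭.adicCompletion K)).toAffine.Point →+ _).range).index =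
      p ^ k := by
    rw [index_torsion_sup_range_zsmul_eq_padic K p 𝔭 h𝔭 he hf W,
      RankOne.range_zsmulAddGroupHom_natCast]
    exact LocalIndex.index_torsion_sup_range_nsmul (G.formalFiltration 2) φ k
  have hL₁ : ∀ k' : ℕ, eQ ≤ k' →
      ((Affine.Point.baseChange (W' := W.baseChange K) K (𝔭.adicCompletion K)).range ⊔
        (zsmulAddGroupHom ((p ^ k' : ℕ) : ℤ) :
          ((W.baseChange K).baseChange (𝔭.adicCompletion K)).toAffine.Point →+ _).range).index =
        p ^ (eQ - g) := by
    intro k' hk'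
    have h := hL₁g k' hk'
    have hsplitpow : p ^ eQ = p ^ (eQ - g) * p ^ g := by rw [← pow_add, Nat.sub_add_cancel hgeQ]
    rw [hsplitpow] at h
    exact Nat.eq_of_mul_eq_mul_right (pow_pos hp.pos g) h
  have hL₂ : ∀ k' : ℕ, eQ - m ≤ k' →
      ((Affine.Point.baseChange (W' := W.baseChange K) K (𝔭.adicCompletion K)).range ⊔
        (AddCommGroup.torsion ((W.baseChange K).baseChange (𝔭.adicCompletion K)).toAffine.Point ⊔
          (zsmulAddGroupHom ((p ^ k' : ℕ) : ℤ) :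
            ((W.baseChange K).baseChange (𝔭.adicCompletion K)).toAffine.Point →+ _).range)).index =
        p ^ (eQ - m) := by
    intro k' hk'
    rw [index_range_baseChange_sup_torsion_sup_eq_padic K p 𝔭 h𝔭 he hf W,
      RankOne.range_zsmulAddGroupHom_natCast]
    change (f.range ⊔ (AddCommGroup.torsion G.toAffine.Point ⊔
      (nsmulAddMonoidHom (p ^ k') : G.toAffine.Point →+ _).range)).index = _
    have hrw : f.range ⊔ (AddCommGroup.torsion G.toAffine.Point ⊔
        (nsmulAddMonoidHom (p ^ k') : G.toAffine.Point →+ _).range) =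
        AddCommGroup.torsion G.toAffine.Point ⊔
          ((nsmulAddMonoidHom (p ^ k') : G.toAffine.Point →+ _).range ⊔
            AddSubgroup.zmultiples (f Q)) := by
      rw [← torsion_sup_range_nsmul_sup_range_eq f c Q hA (p ^ k')]
      ac_rfl
    rw [hrw, LocalIndex.index_torsion_sup_range_nsmul_sup_zmultiples (G.formalFiltration 2) φ
      hmrange (f Q) hxinf k', min_eq_right hk']
  have hS := SelmerCount.natCard_sha_inf_torsionBy_eq' E p ht (show t ≤ k by omega)
  have hShaj : ∀ z ∈ E.sha ⊓ AddSubgroup.torsionBy E.galH1 ((p ^ k : ℕ) : ℤ), p ^ t • z = 0 :=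
    fun z hz => SelmerCount.pow_nsmul_eq_zero_of_mem_sha_inf_torsionBy' E p ht k hz
  -- THE EXACT LEVEL COUNT with torsion (door-c6 gen 2)
  obtain ⟨-, hlevel⟩ := natCard_level_eq_of_indices_anyTorsion W K p k 𝔭 𝔮 hKc hk0 σ hσ
    h𝔮p hne hall hPT hEP (exceptionalPlaces W K p h2) (inl_mem_exceptionalPlaces h2)
    (fun v hv => inr_mem_exceptionalPlaces_of_mem h2 hv)
    (fun v hv => inr_mem_exceptionalPlaces_of_not_hasGoodReductionAt h2 hv)
    (inr_mem_exceptionalPlaces_of_mem h2 h𝔮p) hjk hsk hN hM (hL₁ k (by omega))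
    (hL₁ (k - t) (by omega)) (hL₂ k (by omega)) (hL₂ (k - ((eQ - g) + t)) (by omega)) hS hShaj
  -- assemble: `p^g · #Sel = p^t · p^{(eQ-g)+(eQ-m)} · p^g`
  have hSel : Nat.card (selmerAcBase E p 𝔭 ∅) = p ^ (t + ((eQ - g) + (eQ - m))) := by
    have h : p ^ g * Nat.card (selmerAcBase E p 𝔭 ∅) = p ^ g * p ^ (t + ((eQ - g) + (eQ - m))) := by
      rw [← hcount, hlevel, ht, ← pow_add]; ring
    exact Nat.eq_of_mul_eq_mul_left (pow_pos hp.pos g) h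
  refine ⟨hfinSel, t + (eQ - g) + eQ, ?_, ?_⟩
  · rw [← hmcard, hSel, ← pow_add]
    congr 1
    omega
  · have hvS : padicValNat p (Nat.card (AddCommGroup.primaryComponent E.sha p)) = t := by
      rw [ht, padicValNat.prime_pow]
    rw [hvS, hI, htam]
    have hePQZ : (eP : ℤ) = (padicValNat p (c P).natAbs : ℤ) + (eQ : ℤ) := by exact_mod_cast hePQ
    have hcast : (((t + (eQ - g) + eQ : ℕ) : ℤ)) = (t : ℤ) + ((eQ : ℤ) - (g : ℤ)) + (eQ : ℤ) := by
      push_cast [Nat.cast_sub hgeQ]; ring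
    have hcast2 : (((2 * cp : ℕ) : ℤ)) = 2 * (cp : ℤ) := by push_cast; ring
    rw [hcast, hcast2]
    push_cast
    linarith [hePQZ, heP]

end Count

end Summit.BirchSwinnertonDyer.BirchSwinnertonDyer.Theorems.SchneiderFreeAdditiveX3

end
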